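/-
Copyright (c) 2026. All rights reserved.
Released under Apache 2.0 license as described in the file LICENSE.
Authors: abc-iut cell, seat abc-iut-w6-d025 (gen 2; block C / W6, row «Cor36-LOGOBS-TELE»).
-/
import Literature.AnabelianGeometry.AbsoluteAnabelian.AbsTopIII.FrobeniusPictureMLFTelecoreConstruction
import Literature.AnabelianGeometry.AbsoluteAnabelian.AbsTopIII.FrobeniusPictureMLFCoresCompatible
import Mathlib.CategoryTheory.Whiskering

/-!
# [AbsTopIII] Corollary 3.6 (ii)/(iii): the telecore `𝔗_An` with its homotopies normalised OVER `ℰ`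

S. Mochizuki, *Topics in Absolute Anabelian Geometry III*, Cor. 3.6 (ii)–(iii) pp. 79–81 of the
kurims manuscript (`paper:url-5493eb38cbb7`; bib key `MochizukiAbsTopIII2015`); proof of (i)/(iii),
p. 81: "it is immediate from the definitions — i.e., in essence, because the various Galois groups
that appear remain 'undisturbed' …".

Seat abc-iut-L4-t5's `FrobeniusPictureMLFTelecoreConstruction.lean` builds the telecore
`𝔗_An = anTelecore τ hν` of Cor. 3.6 (ii) from structure functors to `𝒳` (`overX`, `φ_An` at `Anab`).
The family of homotopies realising the cores and `𝔖_log` (row «Cor36-K-STEP3», seat abc-iut-w5-d053: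
`glueFamily`, over `coresFamily`) is normalised OVER `ℰ` instead (`Δ.overE`: `𝒳 → ℰ`, `𝒩 → ℰ`,
`Anab → ℰ`, "the Galois group is undisturbed").  For the TELECORE half of Cor. 3.6 (iii), second
clause (`LogObsCompatTelecoreStmt τ`: ONE family on the telecore diagram containing the telecore
family AND `𝔖_log`), this file provides the telecore of the printed shape whose homotopies are the
lifts through the structure functors OVER `ℰ`, so that they agree ON THE NOSE (along the diagram
inclusions, by seat abc-iut-L4-t5's `lift_heq_telecoreInclusion`) with those of `coresFamily` /
`glueFamily`:

* `overE4` — `Δ.overE` restricted to `𝒟_{≤4}`; `φXtoEIsoAtoE : φ_An ⋙ (𝒳 → ℰ) ≅ (Anab → ℰ)` (from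
  `η_An`, `κ_An ⋙ (Anab → ℰ) ≅ 𝟭` and the full faithfulness of `φ_An`); `anCIE`, `anCJE` — the
  observation functor `κ_An` and the telecore functors `φ_□ = φ_An`, `φ_⋎ = φ₁` lie over `ℰ`;
* `teleOverE τ` — the structure functors of `𝒟_An` over `ℰ` (`Anab → ℰ` at the core vertex, fully
  faithful: `fullyFaithfulAtoE`); `anCoreFamilyE`, `anTelecoreE τ` — the core `(𝒟_{≤5}, Anab)` and
  the telecore over it built by `univTelecore` from these data, OF THE PRINTED SHAPE
  (`anTelecoreE_isTelecoreAn`: edges `φ_⋏`, `⋏ ∈ L†`, functors `φ_An` / `φ₁` — the typed (iii) clause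
  quantifies the telecore existentially); `anUnivE τ` — the universal family of `𝒟_An` over `ℰ`
  through `Anab`, whose restriction to the pairs through `Anab` IS the telecore family
  (`anTelecoreE_Jfam`), with homotopies the lifts (`anUnivE_η_eq_lift`).

Pure category theory over the abstract data `Δ`, `τ` (no hypothesis on `id_⋎`: the lifts go through
`Anab → ℰ` only); nothing here takes a side on inter-universal Teichmüller theory or bears on
[IUTchIII] Cor. 3.12.
-/

namespace Literature.AnabelianGeometry.AbsoluteAnabelian

open _root_.CategoryTheory _root_.Quiver

universe u

namespace LogFrobeniusData

open DiagramOfCategories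

variable (Δ : LogFrobeniusData.{u})

/-! ### Structure functors over `ℰ` on `𝒟_{≤4}` and at `Anab` -/

/-- `Δ.overE` restricted to `𝒟_{≤4}`: `(𝒳 → ℰ) ∘ id_⋎` on the first row, `𝒳 → ℰ` at `□`, `𝒩 → ℰ`,
`𝟭` at `ℰ`, with the same isomorphisms `μ`. [cite: MochizukiAbsTopIII2015, Corollary 3.6 (i) p.80] -/
def overE4 : (Δ.sub 4).OverData Δ.E where
  N a := Δ.overE.N a.1
  μ e := Δ.overE.μ e

/-- No telecore edges in the observable shape `(𝒟_{≤5}, Anab)`. [folklore] -/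
private theorem coreShape5_isEmpty_J' : ∀ a, IsEmpty (coreShape5.{u}.J a) :=
  fun _ => inferInstanceAs (IsEmpty PEmpty)

/-- `φ_An` is fully faithful (an equivalence, Cor. 3.6 (ii)). [cite: MochizukiAbsTopIII2015, Corollary 3.6 (ii) p.79] -/
noncomputable def ffφ' : Δ.φ.FullyFaithful := by
  haveI := Δ.φ_equiv
  exact Functor.FullyFaithful.ofFullyFaithful Δ.φ

/-- `φ_An ∘ π_An ≅ 𝟭` on the `Anab` side: `φ_An ⋙ (𝒳 → ℰ) ⋙ κ_An ≅ 𝟭_{Anab}` — from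
`η_An : π_An ∘ φ_An… ` read as `((𝒳 → ℰ) ⋙ κ_An) ⋙ φ_An ≅ 𝟭_𝒳` by cancelling the fully faithful
`φ_An` on the right (`φ_An` an equivalence with quasi-inverse `π_An`, Cor. 3.6 (ii)).
[cite: MochizukiAbsTopIII2015, Corollary 3.6 (ii) p.79] -/
noncomputable def φπIsoId : Δ.φ ⋙ (Δ.XtoE ⋙ Δ.κ) ≅ 𝟭 Δ.A :=
  (Δ.ffφ'.whiskeringRight Δ.A).preimageIso
    (Functor.associator _ _ _ ≪≫ Functor.isoWhiskerLeft Δ.φ Δ.η ≪≫ Δ.φ.rightUnitor ≪≫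
      Δ.φ.leftUnitor.symm)

/-- **`φ_An` lies over `ℰ`**: `φ_An ⋙ (𝒳 → ℰ) ≅ (Anab → ℰ)` (through `κ_An ⋙ (Anab → ℰ) ≅ 𝟭` and
`φπIsoId`). [cite: MochizukiAbsTopIII2015, Corollary 3.6 (ii) p.79] -/
noncomputable def φXtoEIsoAtoE : Δ.φ ⋙ Δ.XtoE ≅ Δ.AtoE :=
  (Δ.φ ⋙ Δ.XtoE).rightUnitor.symm ≪≫ Functor.isoWhiskerLeft (Δ.φ ⋙ Δ.XtoE) Δ.κ_inv.symm ≪≫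
    (Functor.associator (Δ.φ ⋙ Δ.XtoE) Δ.κ Δ.AtoE).symm ≪≫
      Functor.isoWhiskerRight (Functor.associator Δ.φ Δ.XtoE Δ.κ ≪≫ Δ.φπIsoId) Δ.AtoE ≪≫
        Δ.AtoE.leftUnitor

/-- The observation functor `κ_An` of `(𝒟_{≤5}, Anab)` lies over `ℰ`: `κ_An ⋙ (Anab → ℰ) ≅ 𝟭`.
[cite: MochizukiAbsTopIII2015, Corollary 3.6 (i) p.80] -/
def anCIE : ∀ (a : SubVertex {a : LFVertex | a.row ≤ 4}) (i : coreI5.{u} a),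
    Δ.coreExt5.obsMap i ⋙ Δ.AtoE ≅ Δ.overE4.N a
  | ⟨.fourth, _⟩, _ => Δ.κ_inv
  | ⟨.row1 _, _⟩, i => PEmpty.elim i
  | ⟨.nexus, _⟩, i => PEmpty.elim i
  | ⟨.third, _⟩, i => PEmpty.elim i
  | ⟨.fifth, _⟩, i => PEmpty.elim i
  | ⟨.sixth, _⟩, i => PEmpty.elim i

variable (τ : Δ.TelecoreData)

/-- The telecore functors lie over `ℰ`: `φ_□ ⋙ (𝒳 → ℰ) ≅ (Anab → ℰ)` and
`φ_⋎ ⋙ id_⋎ ⋙ (𝒳 → ℰ) ≅ (Anab → ℰ)` (through `e : φ_⋎ ⋙ id_⋎ ≅ φ_An`).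
[cite: MochizukiAbsTopIII2015, Corollary 3.6 (ii) p.79] -/
noncomputable def anCJE : ∀ (a : SubVertex {a : LFVertex | a.row ≤ 4}) (j : anJ.{u} a),
    Δ.anTelMap τ j ⋙ Δ.overE4.N a ≅ Δ.AtoE
  | ⟨.row1 _, _⟩, _ =>
    (Functor.associator _ _ _).symm ≪≫ Functor.isoWhiskerRight τ.e Δ.XtoE ≪≫ Δ.φXtoEIsoAtoE
  | ⟨.nexus, _⟩, _ => Δ.φXtoEIsoAtoE
  | ⟨.third, _⟩, j => PEmpty.elim j
  | ⟨.fourth, _⟩, j => PEmpty.elim j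
  | ⟨.fifth, _⟩, j => PEmpty.elim j
  | ⟨.sixth, _⟩, j => PEmpty.elim j

/-! ### The core and telecore over `ℰ`, the universal family through `Anab` -/

/-- **The structure functors of `𝒟_An` over `ℰ`** (`overE4` on `𝒟_{≤4}`, `Anab → ℰ` at the core
vertex, the telecore functors by `anCJE`). [cite: MochizukiAbsTopIII2015, Corollary 3.6 (ii) p.80] -/
noncomputable def teleOverE : (Δ.teleDiagram anJ (Δ.anTelMap τ)).OverData Δ.E :=
  teleOver coreShape5 Δ.coreExt5 Δ.overE4 Δ.AtoE Δ.anCIE anJ (Δ.anTelMap τ) (Δ.anCJE τ)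

/-- The structure functor at the core vertex `Anab` is fully faithful (`Anab → ℰ` is a
quasi-inverse of the equivalence `κ_An`). [cite: MochizukiAbsTopIII2015, Definition 3.1 (vi) p.70] -/
noncomputable def anFFE : ∀ w : (teleShape anJ.{u}).Vertex, w = (teleShape anJ.{u}).obs →
    ((Δ.teleOverE τ).N w).FullyFaithful :=
  fun w h => by subst h; exact Δ.fullyFaithfulAtoE

/-- The core family of `(𝒟_{≤5}, Anab)` over `ℰ` (its homotopies are the lifts through `Anab → ℰ`).
[cite: MochizukiAbsTopIII2015, Corollary 3.6 (i) p.79] -/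
noncomputable def anCoreFamilyE : Δ.core5Diagram.HomotopyFamily :=
  univCoreFamily coreShape5 coreShape5_isEmpty_J' Δ.coreExt5 Δ.overE4 Δ.AtoE Δ.anCIE
    Δ.fullyFaithfulAtoE

/-- **The telecore `𝔗_An` over `ℰ`**: over the core `(𝒟_{≤5}, Anab)` (family `anCoreFamilyE`),
telecore edges `φ_⋏`, `⋏ ∈ L†`, telecore family `𝒥` = the universal family through `Anab`
restricted to the pairs `([γ₃]∘[γ₁], [γ₃]∘[γ₂])`. [cite: MochizukiAbsTopIII2015, Corollary 3.6 (ii) p.79] -/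
noncomputable def anTelecoreE :
    (Δ.sub 4).Telecore (Δ.coreObs5 Δ.anCoreFamilyE (univCoreFamily_terminal _ _ _ _ _ _ _))
      (univCoreObs_isCore coreShape5 coreShape5_isEmpty_J' Δ.coreExt5 Δ.overE4 Δ.AtoE Δ.anCIE
        Δ.fullyFaithfulAtoE reaches5) :=
  univTelecore coreShape5 coreShape5_isEmpty_J' Δ.coreExt5 Δ.overE4 Δ.AtoE Δ.anCIE
    Δ.fullyFaithfulAtoE anJ (Δ.anTelMap τ) (Δ.anCJE τ) (· = (teleShape anJ.{u}).obs) (Δ.anFFE τ)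
    rfl reaches5

/-- `𝔗_An` over `ℰ` has the printed shape: one edge `φ_⋏` to each `⋏ ∈ L†`, functors `φ_An` / `φ₁`.
[cite: MochizukiAbsTopIII2015, Corollary 3.6 (ii) p.79] -/
theorem anTelecoreE_isTelecoreAn : Δ.IsTelecoreAn τ (Δ.anTelecoreE τ) where
  edges_iff a := by
    obtain ⟨a, ha⟩ := a
    cases a with
    | row1 n => exact ⟨fun _ => by simp [LFVertex.row], fun _ => ⟨PUnit.unit⟩⟩
    | nexus => exact ⟨fun _ => by simp [LFVertex.row], fun _ => ⟨PUnit.unit⟩⟩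
    | third => exact ⟨fun ⟨j⟩ => PEmpty.elim j, fun h => by simp [LFVertex.row] at h⟩
    | fourth => exact ⟨fun ⟨j⟩ => PEmpty.elim j, fun h => by simp [LFVertex.row] at h⟩
    | fifth => exact (not_fifth_le_four ha).elim
    | sixth => exact ⟨fun ⟨j⟩ => PEmpty.elim j, fun h => by simp [LFVertex.row] at h⟩
  edges_subsingleton a := by
    obtain ⟨a, ha⟩ := a
    cases a with
    | row1 n => exact inferInstanceAs (Subsingleton PUnit)
    | nexus => exact inferInstanceAs (Subsingleton PUnit)
    | third => exact inferInstanceAs (Subsingleton PEmpty)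
    | fourth => exact inferInstanceAs (Subsingleton PEmpty)
    | fifth => exact inferInstanceAs (Subsingleton PEmpty)
    | sixth => exact inferInstanceAs (Subsingleton PEmpty)
  telMap_nexus _ _ := rfl
  telMap_row1 _ _ _ := rfl

/-- **The universal family of `𝒟_An` over `ℰ` through `Anab`** (boundary set: the pairs factoring
through the core vertex). [cite: MochizukiAbsTopIII2015, Corollary 3.6 (ii) p.79] -/
noncomputable def anUnivE : (Δ.teleDiagram anJ (Δ.anTelMap τ)).HomotopyFamily :=
  teleUnivFamily coreShape5 Δ.coreExt5 Δ.overE4 Δ.AtoE Δ.anCIE anJ (Δ.anTelMap τ) (Δ.anCJE τ)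
    (· = (teleShape anJ.{u}).obs) (Δ.anFFE τ)

/-- The boundary set of the universal family: the pairs factoring through `Anab`.
[cite: MochizukiAbsTopIII2015, Definition 3.5 (iv) p.76] -/
theorem anUnivE_E_iff {a b : (teleShape anJ.{u}).Vertex} (P Q : Path a b) :
    (Δ.anUnivE τ).E P Q ↔ univE (· = (teleShape anJ.{u}).obs) P Q := Iff.rfl

/-- Every co-verticial pair INTO `Anab` lies in the universal boundary set.
[cite: MochizukiAbsTopIII2015, Definition 3.5 (iv) p.76] -/
theorem anUnivE_E_of_obs {a : (teleShape anJ.{u}).Vertex} (p q : Path a (teleShape anJ.{u}).obs) :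
    (Δ.anUnivE τ).E p q :=
  univE_of_mem (· = (teleShape anJ.{u}).obs) rfl p q

/-- On a pair into `Anab` the universal homotopy is the lift through `Anab → ℰ`.
[cite: MochizukiAbsTopIII2015, Definition 3.5 (ii) p.75] -/
theorem anUnivE_η_eq_lift {a : (teleShape anJ.{u}).Vertex} (p q : Path a (teleShape anJ.{u}).obs)
    (h : (Δ.anUnivE τ).E p q) :
    (Δ.anUnivE τ).η h = (Δ.teleOverE τ).lift (Δ.anFFE τ _ rfl) p q :=
  teleUnivFamily_η_eq_lift coreShape5 Δ.coreExt5 Δ.overE4 Δ.AtoE Δ.anCIE anJ (Δ.anTelMap τ)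
    (Δ.anCJE τ) (· = (teleShape anJ.{u}).obs) (Δ.anFFE τ) rfl p q h

/-- The universal homotopies are computed by ANY decomposition through `Anab`.
[cite: MochizukiAbsTopIII2015, Definition 3.5 (ii) p.75] -/
theorem anUnivE_η_eq_decomp {a b : (teleShape anJ.{u}).Vertex} {P Q : Path a b}
    (h : (Δ.anUnivE τ).E P Q) (d : Decomp (· = (teleShape anJ.{u}).obs) P Q) :
    (Δ.anUnivE τ).η h = d.η (Δ.teleOverE τ) (· = (teleShape anJ.{u}).obs) (Δ.anFFE τ) :=
  univFamily_η_eq (Δ.teleOverE τ) _ (Δ.anFFE τ) h d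

/-- **The telecore family `𝒥` of `𝔗_An` over `ℰ` IS the universal family restricted to the pairs
through `Anab`** (definitional). [cite: MochizukiAbsTopIII2015, Definition 3.5 (iv) p.76] -/
theorem anTelecoreE_Jfam :
    (Δ.anTelecoreE τ).Jfam =
      (Δ.anUnivE τ).restrictBoundary (univE (· = (teleShape anJ.{u}).obs)) (isSaturated_univE _)
        (univE_obs_subset coreShape5 Δ.coreExt5 Δ.overE4 Δ.AtoE Δ.anCIE anJ (Δ.anTelMap τ)
          (Δ.anCJE τ) (· = (teleShape anJ.{u}).obs) (Δ.anFFE τ) rfl) :=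
  rfl

/-- The telecore functors and the family of telecore edges of `𝔗_An` over `ℰ` (definitional).
[cite: MochizukiAbsTopIII2015, Corollary 3.6 (ii) p.79] -/
theorem anTelecoreE_J : (Δ.anTelecoreE τ).J = anJ := rfl

end LogFrobeniusData

end Literature.AnabelianGeometry.AbsoluteAnabelian
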